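import Mathlib
import Summits.MatrixMultiplication.MatrixMultiplication.Theorems.SubgroupIdentityDesigns.Negative.ProjectiveLineAction

/-!
# Eigenlines of `2 × 2` matrices over `𝔽_p` on the projective line over `K̄`

Route `LevelGradedCohnUmans`, crux `SubgroupIdentityDesigns` (stmt-MatrixMultiplication-14079), cell
`(m,k) = (2,1)`.  VALUE = THEOREM (elementary), NOT summit progress.  Third file of the in-Lean
proof of the named hypothesis `DicksonList` (`DicksonReduction.lean`).

For a non-scalar `g ∈ GL₂(𝔽_p)` with non-zero discriminant (`p` odd) we construct an eigenbasis
`u, w` over `K̄` with distinct eigenvalues (`EigenData`, `exists_eigenData`) and prove: the fixed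
points of `g` on `PL p` are exactly the two points `[u] ≠ [w]` (`fixedBy_eq_pair`, `mk_ne`); an `h`
fixing both commutes with `g` (`comm_of_fix`); an `h` swapping them anti-commutes with every
trace-zero element of `𝔽_p·1 + 𝔽_p·g` (`anticomm_of_swap`).
-/

set_option linter.dupNamespace false

noncomputable section

open scoped BigOperators Classical

open Summit.MatrixMultiplication.MatrixMultiplication.Theorems.LieRankDesigns.Negative (GLm Mat)

namespace Summit.MatrixMultiplication.MatrixMultiplication.Theorems.SubgroupIdentityDesigns.Negative

section EigenLines

variable {p : ℕ} [hp : Fact p.Prime]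

/-! ### Eigen-data over `K̄` -/

/-- Base change of `a·1 + b·M`. -/
theorem map_affine {R S : Type*} [CommRing R] [CommRing S] (f : R →+* S) (a b : R)
    (M : Matrix (Fin 2) (Fin 2) R) :
    (a • (1 : Matrix (Fin 2) (Fin 2) R) + b • M).map f =
      f a • (1 : Matrix (Fin 2) (Fin 2) S) + f b • M.map f := by
  ext i j; fin_cases i <;> fin_cases j <;> simp

/-- An eigenbasis of `g` over `K̄` with distinct eigenvalues. -/
structure EigenData (g : GLm p 2) where
  /-- first eigenvector -/
  u : Fin 2 → Kb p
  /-- second eigenvector -/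
  w : Fin 2 → Kb p
  /-- first eigenvalue -/
  μ : Kb p
  /-- second eigenvalue -/
  ν : Kb p
  /-- `u ≠ 0` -/
  hu : u ≠ 0
  /-- `w ≠ 0` -/
  hw : w ≠ 0
  /-- `g u = μ u` -/
  gu : (gK g).mulVec u = μ • u
  /-- `g w = ν w` -/
  gw : (gK g).mulVec w = ν • w
  /-- `μ + ν = tr g` -/
  sum : μ + ν = ιK p ((g : Mat p 2) 0 0 + (g : Mat p 2) 1 1)
  /-- the eigenvalues are distinct -/
  ne : μ ≠ ν

/-- `2 ≠ 0` in `K̄` for odd `p`. -/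
theorem two_ne_zero_K (hp2 : p ≠ 2) : (2 : Kb p) ≠ 0 := by
  have h := Literature.NumberTheory.EllipticCurves.BinaryQuartic.two_ne_zero_zmod (p := p) hp2
  intro h0
  apply h
  apply ιK_injective
  rw [map_ofNat, map_zero]; exact h0

/-- **Existence of eigen-data** for a non-scalar `g` with non-zero discriminant (`p` odd). -/
theorem exists_eigenData (hp2 : p ≠ 2) {g : GLm p 2}
    (hΔ : disc (g : Mat p 2) ≠ 0) : Nonempty (EigenData g) := by
  set M := gK g with hM
  set t : Kb p := ιK p ((g : Mat p 2) 0 0 + (g : Mat p 2) 1 1) with ht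
  set d : Kb p := ιK p ((g : Mat p 2) 0 0 * (g : Mat p 2) 1 1 - (g : Mat p 2) 0 1 * (g : Mat p 2) 1 0)
    with hd
  have hΔK : t ^ 2 - 4 * d ≠ 0 := by
    have : t ^ 2 - 4 * d = ιK p (disc (g : Mat p 2)) := by
      simp only [ht, hd, disc, map_sub, map_pow, map_mul, map_ofNat]
    rw [this, map_ne_zero_iff _ ιK_injective]; exact hΔ
  obtain ⟨δ, hδ⟩ := IsAlgClosed.exists_pow_nat_eq (t ^ 2 - 4 * d) (n := 2) (by norm_num)
  have hδ0 : δ ≠ 0 := by rintro rfl; apply hΔK; rw [← hδ]; ring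
  have h2 := two_ne_zero_K (p := p) hp2
  set μ : Kb p := (t + δ) / 2 with hμ
  set ν : Kb p := (t - δ) / 2 with hν
  have hsum : μ + ν = t := by rw [hμ, hν]; field_simp; ring
  have hprod : μ * ν = d := by
    have e : μ * ν * (2 * 2) = t ^ 2 - δ ^ 2 := by rw [hμ, hν]; field_simp; ring
    have h4 : (2 : Kb p) * 2 ≠ 0 := mul_ne_zero h2 h2
    exact mul_right_cancel₀ h4 (by rw [e, hδ]; ring)
  have hne : μ ≠ ν := by
    intro h; apply hδ0
    have : μ - ν = δ := by rw [hμ, hν]; field_simp; ring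
    rw [← this, h, sub_self]
  -- eigenvectors from `det (M - λ) = 0`
  have hdet : ∀ c : Kb p, c * c - t * c + d = 0 →
      ∃ v : Fin 2 → Kb p, v ≠ 0 ∧ M.mulVec v = c • v := by
    intro c hc
    have hd0 : (M - c • (1 : Matrix (Fin 2) (Fin 2) (Kb p))).det = 0 := by
      rw [Matrix.det_fin_two]
      simp [hM]
      rw [← hc, ht, hd]; simp only [map_add, map_sub, map_mul]; ring
    obtain ⟨v, hv0, hv⟩ := Matrix.exists_mulVec_eq_zero_iff.mpr hd0
    refine ⟨v, hv0, ?_⟩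
    rw [Matrix.sub_mulVec, Matrix.smul_mulVec, Matrix.one_mulVec, sub_eq_zero] at hv
    exact hv
  obtain ⟨u, hu0, hu⟩ := hdet μ (by
    have : μ * μ - t * μ + d = μ * μ - (μ + ν) * μ + μ * ν := by rw [hsum, hprod]
    rw [this]; ring)
  obtain ⟨w, hw0, hw⟩ := hdet ν (by
    have : ν * ν - t * ν + d = ν * ν - (μ + ν) * ν + μ * ν := by rw [hsum, hprod]
    rw [this]; ring)
  exact ⟨⟨u, w, μ, ν, hu0, hw0, hu, hw, hsum, hne⟩⟩

namespace EigenData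

variable {g : GLm p 2} (E : EigenData g)

/-- Coefficients with respect to `u, w` vanish when the combination does, provided the
`2 × 2` determinant is non-zero. -/
theorem coeff_eq_zero_of_det {u w : Fin 2 → Kb p} (hD : u 0 * w 1 - u 1 * w 0 ≠ 0) {α β : Kb p}
    (h : α • u + β • w = 0) : α = 0 ∧ β = 0 := by
  have h0 := congrFun h 0
  have h1 := congrFun h 1
  simp only [Pi.add_apply, Pi.smul_apply, smul_eq_mul, Pi.zero_apply] at h0 h1
  constructor
  · have : α * (u 0 * w 1 - u 1 * w 0) = 0 := by linear_combination w 1 * h0 - w 0 * h1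
    exact (mul_eq_zero.mp this).resolve_right hD
  · have : β * (u 0 * w 1 - u 1 * w 0) = 0 := by linear_combination u 0 * h1 - u 1 * h0
    exact (mul_eq_zero.mp this).resolve_right hD

/-- The eigenvectors are independent. -/
theorem indep : E.u 0 * E.w 1 - E.u 1 * E.w 0 ≠ 0 := by
  intro hD
  -- `w_1 • u - u_1 • w` and `w_0 • u - u_0 • w` vanish coordinatewise up to `hD`
  have c1 : E.w 1 • E.u = E.u 1 • E.w := by
    funext j; fin_cases j <;> simp only [Pi.smul_apply, smul_eq_mul, Fin.isValue, Fin.zero_eta,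
      Fin.mk_one]
    · linear_combination hD
    · ring
  have c0 : E.w 0 • E.u = E.u 0 • E.w := by
    funext j; fin_cases j <;> simp only [Pi.smul_apply, smul_eq_mul, Fin.isValue, Fin.zero_eta,
      Fin.mk_one]
    · ring
    · linear_combination -hD
  -- apply `g`
  have key : ∀ {a b : Kb p}, a • E.u = b • E.w → a = 0 := by
    intro a b hab
    have h1 := congrArg (gK g).mulVec hab
    rw [Matrix.mulVec_smul, Matrix.mulVec_smul, E.gu, E.gw, smul_smul, smul_smul] at h1
    -- `(a μ) • u = (b ν) • w` and `ν • (a • u) = (ν b) • w`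
    have h2 : (E.ν * a) • E.u = (E.ν * b) • E.w := by rw [← smul_smul, hab, smul_smul]
    have h3 : (a * E.μ - E.ν * a) • E.u = 0 := by
      rw [sub_smul, h1, h2, mul_comm b, sub_self]
    rcases smul_eq_zero.mp h3 with h | h
    · have : a * (E.μ - E.ν) = 0 := by linear_combination h
      exact (mul_eq_zero.mp this).resolve_right (sub_ne_zero.mpr E.ne)
    · exact absurd h E.hu
  have hw1 : E.w 1 = 0 := key c1
  have hw0 : E.w 0 = 0 := key c0
  apply E.hw
  funext j; fin_cases j
  · exact hw0
  · exact hw1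

/-- Coefficients with respect to the eigenbasis are unique. -/
theorem coeff_eq_zero {α β : Kb p} (h : α • E.u + β • E.w = 0) : α = 0 ∧ β = 0 :=
  coeff_eq_zero_of_det E.indep h

/-- Every vector is a combination of the eigenbasis (Cramer). -/
theorem decomp (v : Fin 2 → Kb p) :
    v = ((v 0 * E.w 1 - v 1 * E.w 0) / (E.u 0 * E.w 1 - E.u 1 * E.w 0)) • E.u +
        ((E.u 0 * v 1 - E.u 1 * v 0) / (E.u 0 * E.w 1 - E.u 1 * E.w 0)) • E.w := by
  have hD := E.indep
  funext i
  simp only [Pi.add_apply, Pi.smul_apply, smul_eq_mul]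
  rw [div_mul_eq_mul_div, div_mul_eq_mul_div, ← add_div, eq_div_iff hD]
  fin_cases i <;> simp only [Fin.isValue, Fin.zero_eta, Fin.mk_one] <;> ring

/-- A matrix killing both eigenvectors is zero. -/
theorem eq_zero_of_mulVec {A : Matrix (Fin 2) (Fin 2) (Kb p)} (hu : A.mulVec E.u = 0)
    (hw : A.mulVec E.w = 0) : A = 0 := by
  have hv : ∀ v, A.mulVec v = 0 := by
    intro v
    rw [E.decomp v, Matrix.mulVec_add, Matrix.mulVec_smul, Matrix.mulVec_smul, hu, hw,
      smul_zero, smul_zero, add_zero]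
  ext i j
  have := congrFun (hv (Pi.single j 1)) i
  rw [Matrix.mulVec_single_one] at this
  exact this

/-- The two eigenlines are distinct points. -/
theorem mk_ne : Projectivization.mk (Kb p) E.u E.hu ≠ Projectivization.mk (Kb p) E.w E.hw := by
  intro h
  rw [Projectivization.mk_eq_mk_iff'] at h
  obtain ⟨a, ha⟩ := h
  have : (1 : Kb p) • E.u + (-a) • E.w = 0 := by rw [one_smul, neg_smul, ha, add_neg_cancel]
  have h2 := (E.coeff_eq_zero this).1
  exact one_ne_zero h2

/-- An eigenvector of `g` lies on one of the two eigenlines. -/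
theorem eigen_cases {v : Fin 2 → Kb p} (hv : v ≠ 0) {c : Kb p} (hc : (gK g).mulVec v = c • v) :
    Projectivization.mk (Kb p) v hv = Projectivization.mk (Kb p) E.u E.hu ∨
      Projectivization.mk (Kb p) v hv = Projectivization.mk (Kb p) E.w E.hw := by
  set a := (v 0 * E.w 1 - v 1 * E.w 0) / (E.u 0 * E.w 1 - E.u 1 * E.w 0) with ha
  set b := (E.u 0 * v 1 - E.u 1 * v 0) / (E.u 0 * E.w 1 - E.u 1 * E.w 0) with hb
  have hdec : v = a • E.u + b • E.w := E.decomp v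
  have h1 : (gK g).mulVec v = (a * E.μ) • E.u + (b * E.ν) • E.w := by
    rw [hdec, Matrix.mulVec_add, Matrix.mulVec_smul, Matrix.mulVec_smul, E.gu, E.gw, smul_smul,
      smul_smul]
  have h2 : (a * E.μ - c * a) • E.u + (b * E.ν - c * b) • E.w = 0 := by
    have ethis : c • v = (c * a) • E.u + (c * b) • E.w := by
      conv_lhs => rw [hdec]
      rw [smul_add, smul_smul, smul_smul]
    have e3 : (a * E.μ) • E.u + (b * E.ν) • E.w = (c * a) • E.u + (c * b) • E.w := by
      rw [← h1, hc, ethis]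
    rw [sub_smul, sub_smul]
    calc (a * E.μ) • E.u - (c * a) • E.u + ((b * E.ν) • E.w - (c * b) • E.w)
        = ((a * E.μ) • E.u + (b * E.ν) • E.w) - ((c * a) • E.u + (c * b) • E.w) := by abel
      _ = 0 := by rw [e3, sub_self]
  obtain ⟨ea, eb⟩ := E.coeff_eq_zero h2
  by_cases ha0 : a = 0
  · right
    rw [Projectivization.mk_eq_mk_iff']
    exact ⟨b, by rw [hdec, ha0, zero_smul, zero_add]⟩
  by_cases hb0 : b = 0
  · left
    rw [Projectivization.mk_eq_mk_iff']
    exact ⟨a, by rw [hdec, hb0, zero_smul, add_zero]⟩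
  exfalso; apply E.ne
  have hμ : E.μ = c := by
    have : a * (E.μ - c) = 0 := by linear_combination ea
    exact sub_eq_zero.mp ((mul_eq_zero.mp this).resolve_left ha0)
  have hν : E.ν = c := by
    have : b * (E.ν - c) = 0 := by linear_combination eb
    exact sub_eq_zero.mp ((mul_eq_zero.mp this).resolve_left hb0)
  rw [hμ, hν]

/-- **The fixed points of `g` are exactly the two eigenlines.** -/
theorem fixedBy_eq_pair : MulAction.fixedBy (PL p) g =
    {Projectivization.mk (Kb p) E.u E.hu, Projectivization.mk (Kb p) E.w E.hw} := by
  ext x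
  rw [MulAction.mem_fixedBy, Set.mem_insert_iff, Set.mem_singleton_iff]
  induction x using Projectivization.ind with
  | h v hv =>
    constructor
    · intro h
      obtain ⟨c, hc⟩ := (smul_mk_eq_mk_iff g hv hv).mp h
      exact E.eigen_cases hv hc.symm
    · rintro (h | h) <;> rw [h, smul_mk_eq_mk_iff]
      · exact ⟨E.μ, E.gu.symm⟩
      · exact ⟨E.ν, E.gw.symm⟩

/-- **An element fixing both eigenlines commutes with `g`.** -/
theorem comm_of_fix {h : GLm p 2}
    (h1 : h • Projectivization.mk (Kb p) E.u E.hu = Projectivization.mk (Kb p) E.u E.hu)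
    (h2 : h • Projectivization.mk (Kb p) E.w E.hw = Projectivization.mk (Kb p) E.w E.hw) :
    (h : Mat p 2) * (g : Mat p 2) = (g : Mat p 2) * (h : Mat p 2) := by
  obtain ⟨α, hα⟩ := (smul_mk_eq_mk_iff h E.hu E.hu).mp h1
  obtain ⟨β, hβ⟩ := (smul_mk_eq_mk_iff h E.hw E.hw).mp h2
  have hK : gK h * gK g = gK g * gK h := by
    rw [← sub_eq_zero]
    apply E.eq_zero_of_mulVec
    · rw [Matrix.sub_mulVec, ← Matrix.mulVec_mulVec, ← Matrix.mulVec_mulVec, E.gu, ← hα,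
        Matrix.mulVec_smul, Matrix.mulVec_smul, ← hα, E.gu, smul_comm, sub_self]
    · rw [Matrix.sub_mulVec, ← Matrix.mulVec_mulVec, ← Matrix.mulVec_mulVec, E.gw, ← hβ,
        Matrix.mulVec_smul, Matrix.mulVec_smul, ← hβ, E.gw, smul_comm, sub_self]
  rw [← gK_mul, ← gK_mul] at hK
  have := Matrix.map_injective (ιK_injective (p := p)) hK
  simpa only [Units.val_mul] using this

/-- **An element swapping the eigenlines anti-commutes with every trace-zero element of
`𝔽_p·1 + 𝔽_p·g`.** -/
theorem anticomm_of_swap {h : GLm p 2}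
    (h1 : h • Projectivization.mk (Kb p) E.u E.hu = Projectivization.mk (Kb p) E.w E.hw)
    (h2 : h • Projectivization.mk (Kb p) E.w E.hw = Projectivization.mk (Kb p) E.u E.hu)
    (a b : ZMod p) (htr : 2 * a + b * ((g : Mat p 2) 0 0 + (g : Mat p 2) 1 1) = 0) :
    (h : Mat p 2) * (a • (1 : Mat p 2) + b • (g : Mat p 2)) =
      -((a • (1 : Mat p 2) + b • (g : Mat p 2)) * (h : Mat p 2)) := by
  obtain ⟨α, hα⟩ := (smul_mk_eq_mk_iff h E.hu E.hw).mp h1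
  obtain ⟨β, hβ⟩ := (smul_mk_eq_mk_iff h E.hw E.hu).mp h2
  set rK : Matrix (Fin 2) (Fin 2) (Kb p) := (ιK p a) • 1 + (ιK p b) • gK g with hrK
  have hmap : (a • (1 : Mat p 2) + b • (g : Mat p 2)).map (ιK p) = rK := by
    rw [hrK, map_affine]; rfl
  have ru : rK.mulVec E.u = (ιK p a + ιK p b * E.μ) • E.u := by
    rw [hrK, Matrix.add_mulVec, Matrix.smul_mulVec, Matrix.smul_mulVec, Matrix.one_mulVec, E.gu,
      smul_smul, add_smul]
  have rw' : rK.mulVec E.w = (ιK p a + ιK p b * E.ν) • E.w := by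
    rw [hrK, Matrix.add_mulVec, Matrix.smul_mulVec, Matrix.smul_mulVec, Matrix.one_mulVec, E.gw,
      smul_smul, add_smul]
  have hσ : (ιK p a + ιK p b * E.μ) + (ιK p a + ιK p b * E.ν) = 0 := by
    have : (ιK p a + ιK p b * E.μ) + (ιK p a + ιK p b * E.ν) =
        ιK p (2 * a + b * ((g : Mat p 2) 0 0 + (g : Mat p 2) 1 1)) := by
      rw [map_add, map_mul, map_mul, map_ofNat, ← E.sum]; ring
    rw [this, htr, map_zero]
  have hK : gK h * rK + rK * gK h = 0 := by
    apply E.eq_zero_of_mulVec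
    · rw [Matrix.add_mulVec, ← Matrix.mulVec_mulVec, ← Matrix.mulVec_mulVec, ru, ← hα,
        Matrix.mulVec_smul, Matrix.mulVec_smul, ← hα, rw', smul_smul, smul_smul, ← add_smul]
      have : ιK p b * E.μ = ιK p b * E.μ := rfl
      have e : (ιK p a + ιK p b * E.μ) * α + α * (ιK p a + ιK p b * E.ν) =
          α * ((ιK p a + ιK p b * E.μ) + (ιK p a + ιK p b * E.ν)) := by ring
      rw [e, hσ, mul_zero, zero_smul]
    · rw [Matrix.add_mulVec, ← Matrix.mulVec_mulVec, ← Matrix.mulVec_mulVec, rw', ← hβ,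
        Matrix.mulVec_smul, Matrix.mulVec_smul, ← hβ, ru, smul_smul, smul_smul, ← add_smul]
      have e : (ιK p a + ιK p b * E.ν) * β + β * (ιK p a + ιK p b * E.μ) =
          β * ((ιK p a + ιK p b * E.μ) + (ιK p a + ιK p b * E.ν)) := by ring
      rw [e, hσ, mul_zero, zero_smul]
  rw [← eq_neg_iff_add_eq_zero] at hK
  apply Matrix.map_injective (ιK_injective (p := p))
  show ((h : Mat p 2) * (a • (1 : Mat p 2) + b • (g : Mat p 2))).map (ιK p) =
    (-((a • (1 : Mat p 2) + b • (g : Mat p 2)) * (h : Mat p 2))).map (ιK p)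
  rw [Matrix.map_neg _ (map_neg (ιK p)), Matrix.map_mul, Matrix.map_mul, hmap]
  exact hK

end EigenData

end EigenLines

end Summit.MatrixMultiplication.MatrixMultiplication.Theorems.SubgroupIdentityDesigns.Negative

end
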